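import Literature.Probability.RandomPlanarGeometry.ChordalCapacityDivergence
import Literature.Probability.RandomPlanarGeometry.BoundaryCorrespondence
import Literature.Probability.RandomPlanarGeometry.HalfPlaneFill
import Literature.Probability.RandomPlanarGeometry.CurveSpace
import HarnessLib

/-!
# Path-piece lemma — helper stub `stub_rangeIsArc_pieces` of the line `marked-point-revisit`
(crux `SAWLoopFugacityFlow.SimpleSubseqLimits`, stmt-CriticalPhenomena-4982; plan `RangeIsArc-PLAN.md`, M3)

Let `φ : ℍ → D` be a chordal uniformizing map of the Dobrushin domain `(D; a, b)`, `T ⊆ ℂ` closed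
and bounded with `0 ∉ T`, and `c` a curve class from `a` to `b` with trace in `D ∪ {a, b}` (NOT
assumed simple) whose pulled-back trace `φ⁻¹(trace ∩ D)` avoids `T`. Then `0 ∉ Fill(T)`
(`hpFill T`, the half-plane fill of `HalfPlaneFill`) and the pulled-back trace avoids `Fill(T)`.

Proof. Take a parametrisation `γ` of `c`, extended constantly to `ℝ`, and the open parameter set
`P = γ⁻¹(D)`. The pull-back `φ⁻¹ ∘ γ` of a connected component `Q` of `P` (a maximal sub-path
inside `D`) is a connected subset of `ℍ ∖ T`; `Q` is not closed in `ℝ`, so some point `s` of its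
closure has `γ s ∈ {a, b}`. If `γ s = b` the piece runs to `∞` (`φ⁻¹ → ∞` at `b`, Carathéodory)
and lies in the unbounded component `V` of `ℍ ∖ T`; if `γ s = a` the piece comes arbitrarily close
to `0` (`φ⁻¹ → 0` at `a`). (1) `0 ∉ Fill(T)`: otherwise the small upper half-discs at `0` miss `V`;
but the piece ending at the FIRST visit of `b` starts at a visit of `a`, so it is unbounded (in `V`)
and comes close to `0` (off `V`) — contradiction. (2) Given (1), small upper half-discs at `0` lie
in `V`, so every piece lies in `V = ℍ ∖ Fill(T)`.
-/

noncomputable section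

open MeasureTheory Filter Topology Set Metric Bornology
open Literature.Probability.RandomPlanarGeometry
open UpperHalfPlane (upperHalfPlaneSet)
open scoped ENNReal NNReal unitInterval

namespace Summit.CriticalPhenomena.SAWScalingLimit.Theorems.SimpleSubseqLimits.MarkedPointRevisit.ArcRangePieces

variable {D : DobrushinDomain} {φ : ConformalEquiv upperHalfPlaneSet D.carrier} {T : Set ℂ}

/-- Membership in the unbounded component propagates along a preconnected subset of `ℍ ∖ T`.
[folklore] -/
theorem subset_unboundedComponent_of_mem {S : Set ℂ} (hS : IsPreconnected S)
    (hsub : S ⊆ upperHalfPlaneSet \ T) {v : ℂ} (hv : v ∈ S)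
    (hvV : v ∈ Loewner.unboundedComponent (upperHalfPlaneSet \ T)) :
    S ⊆ Loewner.unboundedComponent (upperHalfPlaneSet \ T) := by
  intro z hz
  refine ⟨hsub hz, fun hb ↦ hvV.2 ?_⟩
  have h1 : v ∈ connectedComponentIn (upperHalfPlaneSet \ T) z :=
    hS.subset_connectedComponentIn hz hsub hv
  rw [← connectedComponentIn_eq h1]
  exact hb

/-- Values of the extension `IccExtend` of a curve are values of the curve. [folklore] -/
theorem IccExtend_mem_range (γ : Curve ℂ) (t : ℝ) : IccExtend zero_le_one γ t ∈ γ.range := ⟨_, rfl⟩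

/-- The extension is `γ 0` to the left of `0`. [folklore] -/
theorem IccExtend_of_le_zero (γ : Curve ℂ) {t : ℝ} (ht : t ≤ 0) : IccExtend zero_le_one γ t = γ 0 := by
  rw [IccExtend_of_le_left zero_le_one γ ht]; rfl

/-- The extension is `γ 1` to the right of `1`. [folklore] -/
theorem IccExtend_of_one_le (γ : Curve ℂ) {t : ℝ} (ht : 1 ≤ t) : IccExtend zero_le_one γ t = γ 1 := by
  rw [IccExtend_of_right_le zero_le_one γ ht]; rfl

section Pieces

variable {γ : Curve ℂ}

/-- The pull-back `φ⁻¹ ∘ γ` of a set `Q` of parameters mapped into `D` is a preconnected subset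
of `ℍ ∖ T` when `Q` is preconnected. [folklore] -/
theorem piece_spec (hmiss : ∀ w ∈ γ.range ∩ D.carrier, φ.symm w ∉ T) {Q : Set ℝ}
    (hQ : IsPreconnected Q) (hQP : Q ⊆ IccExtend zero_le_one γ ⁻¹' D.carrier) :
    IsPreconnected ((fun t ↦ φ.symm (IccExtend zero_le_one γ t)) '' Q) ∧
      (fun t ↦ φ.symm (IccExtend zero_le_one γ t)) '' Q ⊆ upperHalfPlaneSet \ T := by
  constructor
  · refine hQ.image _ ((φ.symm.continuousOn.comp (γ.continuous.Icc_extend').continuousOn ?_))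
    exact fun t ht ↦ hQP ht
  · rintro _ ⟨t, ht, rfl⟩
    exact ⟨φ.symm_mapsTo (hQP ht), hmiss _ ⟨IccExtend_mem_range γ t, hQP ht⟩⟩

/-- A component of the parameter set `γ⁻¹(D)` is open. [folklore] -/
theorem isOpen_component (γ : Curve ℂ) (t : ℝ) :
    IsOpen (connectedComponentIn (IccExtend zero_le_one γ ⁻¹' D.carrier) t) := by
  have hP : IsOpen (IccExtend zero_le_one γ ⁻¹' D.carrier) := D.isOpen.preimage (γ.continuous.Icc_extend')
  rw [isOpen_iff_forall_mem_open]
  intro q hq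
  have hqP : q ∈ IccExtend zero_le_one γ ⁻¹' D.carrier := connectedComponentIn_subset _ _ hq
  obtain ⟨ε, hε, hball⟩ := Metric.isOpen_iff.1 hP q hqP
  refine ⟨ball q ε, ?_, isOpen_ball, mem_ball_self hε⟩
  rw [connectedComponentIn_eq hq]
  exact (convex_ball q ε).isPreconnected.subset_connectedComponentIn (mem_ball_self hε) hball

/-- **A maximal sub-path inside `D` ends on `{a, b}`**: some point of the closure of a component
`Q ∋ t` of `γ⁻¹(D)` is mapped outside `D` (otherwise `Q` would be clopen in `ℝ`, but
`γ 0 = a ∉ D`… more simply: `Q` would be all of `ℝ`, containing `0`). [folklore] -/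
theorem exists_mem_closure_notMem (h0 : γ 0 = D.pt 0) {t : ℝ} (ht : IccExtend zero_le_one γ t ∈ D.carrier) :
    ∃ s ∈ closure (connectedComponentIn (IccExtend zero_le_one γ ⁻¹' D.carrier) t), IccExtend zero_le_one γ s ∉ D.carrier := by
  by_contra h
  push Not at h
  set Q := connectedComponentIn (IccExtend zero_le_one γ ⁻¹' D.carrier) t with hQ
  have hcl : closure Q ⊆ Q := by
    have h1 : IsPreconnected (closure Q) := isPreconnected_connectedComponentIn.closure
    exact h1.subset_connectedComponentIn (subset_closure (mem_connectedComponentIn ht)) h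
  have hclopen : IsClopen Q := ⟨closure_subset_iff_isClosed.1 hcl, isOpen_component γ t⟩
  have huniv : Q = univ := (isClopen_iff.1 hclopen).resolve_left (Set.nonempty_iff_ne_empty.1 ⟨t, mem_connectedComponentIn ht⟩)
  have h0Q : (0 : ℝ) ∈ Q := huniv ▸ mem_univ _
  have := connectedComponentIn_subset _ _ h0Q
  rw [mem_preimage, IccExtend_of_le_zero γ le_rfl, h0] at this
  exact D.pt_notMem_carrier 0 this

/-- **A piece reaching `b` is unbounded** (`φ⁻¹ → ∞` at `b` within `D`). [folklore] -/
theorem not_isBounded_piece (hφ : D.IsChordalUniformizing φ) {Q : Set ℝ}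
    (hQP : Q ⊆ IccExtend zero_le_one γ ⁻¹' D.carrier) {s : ℝ}
    (hs : s ∈ closure Q) (hsb : IccExtend zero_le_one γ s = D.pt 1) :
    ¬ IsBounded ((fun t ↦ φ.symm (IccExtend zero_le_one γ t)) '' Q) := by
  intro hb
  obtain ⟨R, hR⟩ := hb.subset_closedBall 0
  haveI : (𝓝[Q] s).NeBot := mem_closure_iff_nhdsWithin_neBot.1 hs
  have h1 : Tendsto (IccExtend zero_le_one γ) (𝓝[Q] s) (𝓝[D.carrier] (D.pt 1)) := by
    refine tendsto_nhdsWithin_iff.2 ⟨?_, eventually_nhdsWithin_of_forall fun q hq ↦ hQP hq⟩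
    rw [← hsb]
    exact ((γ.continuous.Icc_extend').tendsto s).mono_left nhdsWithin_le_nhds
  have h2 := hφ.tendsto_symm_cocompact.comp h1
  have h3 : ∀ᶠ q in 𝓝[Q] s, φ.symm (IccExtend zero_le_one γ q) ∈ (closedBall (0 : ℂ) R)ᶜ :=
    h2 ((isCompact_closedBall 0 R).compl_mem_cocompact)
  have h4 : ∀ᶠ q in 𝓝[Q] s, φ.symm (IccExtend zero_le_one γ q) ∈ closedBall (0 : ℂ) R :=
    eventually_nhdsWithin_of_forall fun q hq ↦ hR ⟨q, hq, rfl⟩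
  obtain ⟨q, hq, hq'⟩ := (h3.and h4).exists
  exact hq hq'

/-- **A piece reaching `a` comes close to `0`** (`φ⁻¹ → 0` at `a` within `D`). [folklore] -/
theorem exists_mem_ball_piece (hφ : D.IsChordalUniformizing φ) {Q : Set ℝ}
    (hQP : Q ⊆ IccExtend zero_le_one γ ⁻¹' D.carrier) {s : ℝ}
    (hs : s ∈ closure Q) (hsa : IccExtend zero_le_one γ s = D.pt 0) {r : ℝ} (hr0 : 0 < r) :
    ∃ q ∈ Q, φ.symm (IccExtend zero_le_one γ q) ∈ ball (0 : ℂ) r := by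
  haveI : (𝓝[Q] s).NeBot := mem_closure_iff_nhdsWithin_neBot.1 hs
  have h1 : Tendsto (IccExtend zero_le_one γ) (𝓝[Q] s) (𝓝[D.carrier] (D.pt 0)) := by
    refine tendsto_nhdsWithin_iff.2 ⟨?_, eventually_nhdsWithin_of_forall fun q hq ↦ hQP hq⟩
    rw [← hsa]
    exact ((γ.continuous.Icc_extend').tendsto s).mono_left nhdsWithin_le_nhds
  have h2 := hφ.tendsto_symm_nhds_zero.comp h1
  have h3 : ∀ᶠ q in 𝓝[Q] s, φ.symm (IccExtend zero_le_one γ q) ∈ ball (0 : ℂ) r := h2 (ball_mem_nhds 0 hr0)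
  obtain ⟨q, hq', hq⟩ := (h3.and self_mem_nhdsWithin).exists
  exact ⟨q, hq, hq'⟩

end Pieces

/-- **Helper stub M3 of `stub_rangeIsArc_tests` — the path-piece lemma.** For a chordal
uniformizing map `φ` of `(D; a, b)`, a closed bounded `T ∌ 0` and a curve class `c` from `a`
to `b` with trace in `D ∪ {a, b}` whose pulled-back trace avoids `T`: `0 ∉ Fill(T)` and the
pulled-back trace avoids `Fill(T)` (module docstring). [folklore] -/
theorem stub_rangeIsArc_pieces :
    ∀ (D : DobrushinDomain) (φ : ConformalEquiv upperHalfPlaneSet D.carrier) (T : Set ℂ)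
      (c : CurveClass ℂ), D.IsChordalUniformizing φ → IsClosed T → Bornology.IsBounded T →
      (0 : ℂ) ∉ T → c.source = D.pt 0 → c.target = D.pt 1 →
      c.range ⊆ D.carrier ∪ {D.pt 0, D.pt 1} →
      (∀ w ∈ c.range ∩ D.carrier, φ.symm w ∉ T) →
      (0 : ℂ) ∉ hpFill T ∧ ∀ w ∈ c.range ∩ D.carrier, φ.symm w ∉ hpFill T := by
  intro D φ T c hφ hT hTb h0T hs ht hr hmiss
  obtain ⟨γ, rfl⟩ := CurveClass.surjective_mk c
  simp only [CurveClass.source_mk, CurveClass.target_mk, CurveClass.range_mk] at hs ht hr hmiss ⊢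
  have h0 : γ 0 = D.pt 0 := hs
  have h1 : γ 1 = D.pt 1 := ht
  have hab : D.pt 0 ≠ D.pt 1 := fun h ↦ zero_ne_one (D.pt_injective h)
  set V := Loewner.unboundedComponent (upperHalfPlaneSet \ T) with hV
  set g : ℝ → ℂ := fun t ↦ φ.symm (IccExtend zero_le_one γ t) with hg
  set P : Set ℝ := IccExtend zero_le_one γ ⁻¹' D.carrier with hP
  obtain ⟨R, hR⟩ := hTb.subset_closedBall 0
  -- every piece with a closure point at `b` lies in `V`
  have hVb : ∀ {Q : Set ℝ}, IsPreconnected Q → Q ⊆ P → ∀ s ∈ closure Q, IccExtend zero_le_one γ s = D.pt 1 →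
      g '' Q ⊆ V := fun hQ hQP s hs hsb ↦ by
    obtain ⟨hpc, hsub⟩ := piece_spec hmiss hQ hQP
    exact subset_unboundedComponent_of_isPreconnected hpc hsub
      (not_isBounded_piece hφ hQP hs hsb)
  -- values off `D` are `a` or `b`
  have hval : ∀ s, IccExtend zero_le_one γ s ∉ D.carrier → IccExtend zero_le_one γ s = D.pt 0 ∨ IccExtend zero_le_one γ s = D.pt 1 := fun s hs ↦ by
    rcases hr (IccExtend_mem_range γ s) with h | h
    · exact absurd h hs
    · simpa using h
  -- (1) `0 ∉ hpFill T`
  have hfill : (0 : ℂ) ∉ hpFill T := by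
    intro h0F
    -- a small upper half-disc at `0` misses `V`
    obtain ⟨r, hr0, hball⟩ := Metric.isOpen_iff.1 hT.isOpen_compl 0 h0T
    set N := ball (0 : ℂ) r ∩ upperHalfPlaneSet with hN
    have hNsub : N ⊆ upperHalfPlaneSet \ T := fun w hw ↦ ⟨hw.2, hball hw.1⟩
    have hNV : ∀ z ∈ N, z ∉ V := by
      intro z hz hzV
      have hNV' : N ⊆ V := subset_unboundedComponent_of_mem
        (((convex_ball (0 : ℂ) r).inter (convex_halfSpace_im_gt 0)).isPreconnected) hNsub hz hzV
      rw [hpFill, mem_closure_iff_nhds] at h0F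
      obtain ⟨w, hwB, hw⟩ := h0F _ (ball_mem_nhds 0 hr0)
      exact hw.2 (hNV' ⟨hwB, hw.1⟩)
    -- the first visit `τ` of `b`
    set Sb : Set ℝ := IccExtend zero_le_one γ ⁻¹' {D.pt 1} ∩ Icc 0 1 with hSb
    have hSbc : IsClosed Sb := (isClosed_singleton.preimage (γ.continuous.Icc_extend')).inter isClosed_Icc
    have h1Sb : (1 : ℝ) ∈ Sb :=
      ⟨by rw [mem_preimage, IccExtend_of_one_le γ le_rfl, h1]; rfl, zero_le_one, le_rfl⟩
    have hbdd : BddBelow Sb := ⟨0, fun x hx ↦ hx.2.1⟩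
    set τ := sInf Sb with hτ
    have hτmem : τ ∈ Sb := hSbc.csInf_mem ⟨1, h1Sb⟩ hbdd
    have hτb : IccExtend zero_le_one γ τ = D.pt 1 := hτmem.1
    have hτle : ∀ x ∈ Sb, τ ≤ x := fun x hx ↦ csInf_le hbdd hx
    have hτpos : 0 < τ := by
      rcases hτmem.2.1.lt_or_eq with h | h
      · exact h
      · exfalso
        have : IccExtend zero_le_one γ τ = D.pt 0 := by
          rw [← h, IccExtend_of_le_zero γ le_rfl, h0]
        exact hab (this.symm.trans hτb)
    have hτ1 : τ ≤ 1 := hτmem.2.2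
    -- just before `τ` the curve is in `D`
    obtain ⟨δ, hδ, hδD⟩ : ∃ δ > 0, ∀ t, τ - δ < t → t < τ → IccExtend zero_le_one γ t ∈ D.carrier := by
      have hc : ContinuousAt (IccExtend zero_le_one γ) τ := (γ.continuous.Icc_extend').continuousAt
      have hev : ∀ᶠ t in 𝓝 τ, dist (IccExtend zero_le_one γ t) (D.pt 1) < dist (D.pt 0) (D.pt 1) := by
        have := hc.eventually (Metric.ball_mem_nhds (IccExtend zero_le_one γ τ) (dist_pos.2 hab))
        filter_upwards [this] with t ht'
        rw [hτb] at ht'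
        exact ht'
      obtain ⟨δ, hδ, hδball⟩ := Metric.eventually_nhds_iff.1 hev
      refine ⟨min δ τ, lt_min hδ hτpos, fun t ht1 ht2 ↦ ?_⟩
      have htδ : dist t τ < δ := by
        rw [Real.dist_eq, abs_sub_lt_iff]; constructor <;> linarith [min_le_left δ τ, min_le_right δ τ]
      have hne_a : IccExtend zero_le_one γ t ≠ D.pt 0 := fun h ↦ by
        have := hδball htδ; rw [h] at this; exact lt_irrefl _ this
      have hne_b : IccExtend zero_le_one γ t ≠ D.pt 1 := fun h ↦ by
        have ht0 : 0 ≤ t := by linarith [min_le_right δ τ]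
        have : τ ≤ t := hτle t ⟨h, ht0, ht2.le.trans hτ1⟩
        linarith
      by_contra hD
      rcases hval t hD with h | h
      · exact hne_a h
      · exact hne_b h
    set t₀ := τ - δ / 2 with ht₀
    have ht₀τ : t₀ < τ := by rw [ht₀]; linarith
    have hIco : Ico t₀ τ ⊆ P := fun t ht' ↦ hδD t (by rw [ht₀] at ht'; linarith [ht'.1]) ht'.2
    have ht₀P : t₀ ∈ P := hIco ⟨le_rfl, ht₀τ⟩
    set Q := connectedComponentIn P t₀ with hQ
    have hQP : Q ⊆ P := connectedComponentIn_subset _ _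
    have hQpc : IsPreconnected Q := isPreconnected_connectedComponentIn
    have hIcoQ : Ico t₀ τ ⊆ Q := isPreconnected_Ico.subset_connectedComponentIn ⟨le_rfl, ht₀τ⟩ hIco
    have hτcl : τ ∈ closure Q := by
      refine closure_mono hIcoQ ?_
      rw [closure_Ico ht₀τ.ne]
      exact ⟨ht₀τ.le, le_rfl⟩
    have hQV : g '' Q ⊆ V := hVb hQpc hQP τ hτcl hτb
    -- `Q ⊆ (0, τ)`
    have hQlt : ∀ q ∈ Q, q < τ := by
      intro q hq
      by_contra hle
      push Not at hle
      have : τ ∈ Q := hQpc.ordConnected.out (hIcoQ ⟨le_rfl, ht₀τ⟩) hq ⟨ht₀τ.le, hle⟩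
      exact D.pt_notMem_carrier 1 (hτb ▸ hQP this)
    have hQpos : ∀ q ∈ Q, 0 < q := by
      intro q hq
      by_contra hle
      push Not at hle
      have : IccExtend zero_le_one γ q = D.pt 0 := by rw [IccExtend_of_le_zero γ hle, h0]
      exact D.pt_notMem_carrier 0 (this ▸ hQP hq)
    -- the left end `u = inf Q` is a visit of `a`
    have hQne : Q.Nonempty := ⟨t₀, hIcoQ ⟨le_rfl, ht₀τ⟩⟩
    have hQbdd : BddBelow Q := ⟨0, fun q hq ↦ (hQpos q hq).le⟩
    set u := sInf Q with hu
    have hucl : u ∈ closure Q := csInf_mem_closure hQne hQbdd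
    have huQ : u ∉ Q := by
      intro huQ
      obtain ⟨ε, hε, hεball⟩ := Metric.isOpen_iff.1 (isOpen_component γ t₀) u huQ
      have : u - ε / 2 ∈ Q := hεball (by rw [mem_ball, Real.dist_eq, abs_of_neg (by linarith)]; linarith)
      have := csInf_le hQbdd this
      linarith
    have huD : IccExtend zero_le_one γ u ∉ D.carrier := by
      intro huD
      have h1' : IsPreconnected (insert u Q) :=
        hQpc.subset_closure (subset_insert _ _) (insert_subset hucl subset_closure)
      have h2' : insert u Q ⊆ P := insert_subset huD hQP
      have h3' := h1'.subset_connectedComponentIn (mem_insert_of_mem _ (hIcoQ ⟨le_rfl, ht₀τ⟩)) h2'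
      rw [← hQ] at h3'
      exact huQ (h3' (mem_insert _ _))
    have hua : IccExtend zero_le_one γ u = D.pt 0 := by
      rcases hval u huD with h | h
      · exact h
      · exfalso
        have hu0 : 0 ≤ u := le_csInf hQne fun q hq ↦ (hQpos q hq).le
        have hut₀ : u ≤ t₀ := csInf_le hQbdd (hIcoQ ⟨le_rfl, ht₀τ⟩)
        have := hτle u ⟨h, hu0, by linarith⟩
        linarith
    obtain ⟨q, hq, hqball⟩ := exists_mem_ball_piece hφ hQP hucl hua hr0
    have hqV : g q ∈ V := hQV ⟨q, hq, rfl⟩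
    exact hNV (g q) ⟨hqball, φ.symm_mapsTo (hQP hq)⟩ hqV
  refine ⟨hfill, ?_⟩
  -- (2) a small upper half-disc at `0` lies in `V`
  obtain ⟨r, hr0, hrV⟩ : ∃ r > 0, ball (0 : ℂ) r ∩ upperHalfPlaneSet ⊆ V := by
    have : (0 : ℂ) ∉ closure (upperHalfPlaneSet \ V) := hfill
    rw [mem_closure_iff_nhds] at this
    push Not at this
    obtain ⟨U, hU, hUV⟩ := this
    obtain ⟨r, hr0, hrU⟩ := Metric.mem_nhds_iff.1 hU
    refine ⟨r, hr0, fun z hz ↦ ?_⟩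
    by_contra hzV
    have : (U ∩ (upperHalfPlaneSet \ V)).Nonempty := ⟨z, hrU hz.1, hz.2, hzV⟩
    rw [hUV] at this
    exact Set.not_nonempty_empty this
  rintro w ⟨⟨t₁, rfl⟩, hwD⟩
  have hwt : IccExtend zero_le_one γ (t₁ : ℝ) = γ t₁ := IccExtend_val zero_le_one γ t₁
  have htP : (t₁ : ℝ) ∈ P := by rw [hP, mem_preimage, hwt]; exact hwD
  set Q := connectedComponentIn P (t₁ : ℝ) with hQ
  have hQP : Q ⊆ P := connectedComponentIn_subset _ _
  have hQpc : IsPreconnected Q := isPreconnected_connectedComponentIn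
  obtain ⟨hpc, hsub⟩ := piece_spec hmiss hQpc hQP
  have hQV : g '' Q ⊆ V := by
    obtain ⟨s, hs, hsD⟩ := exists_mem_closure_notMem h0 htP
    rcases hval s hsD with hsa | hsb
    · obtain ⟨q, hq, hqball⟩ := exists_mem_ball_piece hφ hQP hs hsa hr0
      exact subset_unboundedComponent_of_mem hpc hsub ⟨q, hq, rfl⟩
        (hrV ⟨hqball, φ.symm_mapsTo (hQP hq)⟩)
    · exact hVb hQpc hQP s hs hsb
  have hgV : g t₁ ∈ V := hQV ⟨t₁, mem_connectedComponentIn htP, rfl⟩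
  intro hF
  have hmem : φ.symm (γ t₁) ∈ hpFill T ∩ upperHalfPlaneSet := ⟨hF, φ.symm_mapsTo hwD⟩
  rw [hpFill_inter hT hTb] at hmem
  apply hmem.2
  have : g t₁ = φ.symm (γ t₁) := by rw [hg]; simp only; rw [hwt]
  rwa [this] at hgV

end Summit.CriticalPhenomena.SAWScalingLimit.Theorems.SimpleSubseqLimits.MarkedPointRevisit.ArcRangePieces

end
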